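import Mathlib
import Summits.ValiantsHypothesis.ValiantsHypothesis.Theorems.LacunarySymmetroidMatrixDescartesCensusWindowFourWitnessMult
import Summits.ValiantsHypothesis.ValiantsHypothesis.Theorems.LacunarySymmetroidMatrixDescartesCensusWindowFourWitnessMultRight
import Summits.ValiantsHypothesis.ValiantsHypothesis.Theorems.LacunarySymmetroidMatrixDescartesCensusWindowFourWitnessParam

/-!
# `MatrixDescartes` census — WINDOW-4 PARAMETRIC ROWS, SHARPENED (the `e`-terms of `T₂` and `Φ` kept exactly)

HONEST FRAMING.  Object-search cell `pub-symmetroid`, door-A target `DoorA26 := PosRootLawAt 2 6 19`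
(stmt-ValiantsHypothesis-19979; OPEN, typed, never asserted).  Companion of `…CensusWindowFourWitnessParam` (val-sym-door-p1 g9) and
`…CensusWindowFourWitnessMult` / `…MultRight` (engine-2 g30).  The parametric rows there derive the one-point centre witness
(`T₂(r) < 0 < Φ(r)` left of the common centre, resp. `T₂(r) > 0 > Φ(r)` right of it) from MONOMIAL hypotheses by DROPPING the
`e`-term of `Φ` (left: `V c r^(u+v) < U a ⇒ Φ(r) > 0`) and of `T₂` (right: `(u+v) c r^v < u b ⇒ T₂(r) > 0`).  Here both terms are
kept, still with monomial (log-linear) hypotheses: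

* `fourNomial_countP_posRoots_le_two_of_left_param_kappa` — LEFT(λ, κ), `κ ≥ 0`: the dropped hypothesis `(vc)^v ρ^(u+v) < (ua)^v` is
  replaced by the pair `(vc)^v ρ^(u+v) < ((1+κ)ua)^v` and `(κua)^v ≤ ((v+w)e)^v ρ^(u+v+w)` (together `Φ(r) > 0`); `κ = 0` is the old row.
* `fourNomial_countP_posRoots_le_two_of_right_param_sharp` — RIGHT(μ, t): with the centre tie `(v+w)(u+v+w)e r^w = μ v(u+v) c` one has
  `(v+w)·T₂(r) = (v+w)ub − ((v+w) − μv)(u+v)c r^v` EXACTLY, so `T₂(r) > 0` follows from `(((v+w)−μv)(u+v)c)^w ρ^v < ((v+w)ub)^w`, and holds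
  with NO hypothesis when `μv ≥ v+w`.

Read contrapositively these are the disjunctive «W4 point cuts» of the located instrument hybrid35 (engine-2 g34, `w4rows2.py`;
located memo `W4-COVERAGE-E2G34.md`: at LP-alive points of the h31/h33 trees the old grid separates 3–12 % of the 4-windows violating the
true window condition, the sharpened rows with a searched witness point separate all of them).  Nothing here bounds any census count;
`DoorA26` OPEN; nothing on `MatrixDescartes` (stmt-ValiantsHypothesis-18050) or `VP ≠ VNP`.

[folklore] `v`-th / `w`-th roots + the centre witness rows with multiplicity; elementary.
-/

-- `Summit.ValiantsHypothesis.ValiantsHypothesis.…` repeats a component by the D-0017 layout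
-- (single-conjunct summit), which the `dupNamespace` linter flags; the name is mandated.
set_option linter.dupNamespace false

namespace Summit.ValiantsHypothesis.ValiantsHypothesis.Theorems.LacunarySymmetroidMatrixDescartes.Census

open Polynomial Finset Set
open scoped BigOperators Polynomial

/-- **PARAMETRIC LEFT ROW WITH `κ`, WITH MULTIPLICITY.**  `u, v, w ≥ 1`, `a, b, c, e > 0`, `λ` real, `κ ≥ 0`,
`ρ := λ·u·b/((u+v)·c) > 0`.  If `ρ^w·((v+w)(u+v+w)e)^v ≤ (v(u+v)c)^v` (the point `r = ρ^(1/v)` is at or left of the common centre),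
`((u+v+w)e)^v·ρ^(v+w) < ((λ−1)ub)^v` (`T₂(r) < 0`), `(vc)^v·ρ^(u+v) < ((1+κ)ua)^v` and `(κua)^v ≤ ((v+w)e)^v·ρ^(u+v+w)`
(together `Φ(r) > 0`), the window 4-nomial has at most two positive roots COUNTED WITH MULTIPLICITY. [folklore] -/
theorem fourNomial_countP_posRoots_le_two_of_left_param_kappa {u v w : ℕ} (hu : 0 < u) (hv : 0 < v) (hw : 0 < w)
    {a b c e lam kap : ℝ} (ha : 0 < a) (hb : 0 < b) (hc : 0 < c) (he : 0 < e) (hkap : 0 ≤ kap) {ρ : ℝ} (hρ : 0 < ρ)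
    (hρdef : ρ * (((u : ℝ) + v) * c) = lam * ((u : ℝ) * b))
    (h1 : ρ ^ w * ((((v : ℝ) + w) * ((u : ℝ) + v + w) * e)) ^ v ≤ ((v : ℝ) * ((u : ℝ) + v) * c) ^ v)
    (h2 : (((u : ℝ) + v + w) * e) ^ v * ρ ^ (v + w) < ((lam - 1) * ((u : ℝ) * b)) ^ v)
    (h2' : 0 ≤ (lam - 1) * ((u : ℝ) * b))
    (h3a : ((v : ℝ) * c) ^ v * ρ ^ (u + v) < ((1 + kap) * ((u : ℝ) * a)) ^ v)
    (h3b : (kap * ((u : ℝ) * a)) ^ v ≤ (((v : ℝ) + w) * e) ^ v * ρ ^ (u + v + w)) :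
    (C a - C b * X ^ u + C c * X ^ (u + v) - C e * X ^ (u + v + w)).roots.countP (fun x => 0 < x) ≤ 2 := by
  obtain ⟨r, hr, hrv⟩ := exists_pos_pow_eq hρ hv
  have hvne : v ≠ 0 := hv.ne'
  have hrw : (r ^ w) ^ v = ρ ^ w := by rw [← pow_mul, mul_comm, pow_mul, hrv]
  have hrvw : (r ^ (v + w)) ^ v = ρ ^ (v + w) := by rw [← pow_mul, mul_comm, pow_mul, hrv]
  have hruv : (r ^ (u + v)) ^ v = ρ ^ (u + v) := by rw [← pow_mul, mul_comm, pow_mul, hrv]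
  have hruvw : (r ^ (u + v + w)) ^ v = ρ ^ (u + v + w) := by rw [← pow_mul, mul_comm, pow_mul, hrv]
  -- centre
  have hcen : ((v : ℝ) + w) * ((u : ℝ) + v + w) * e * r ^ w ≤ (v : ℝ) * ((u : ℝ) + v) * c := by
    have hx : 0 ≤ ((v : ℝ) + w) * ((u : ℝ) + v + w) * e * r ^ w := by positivity
    have hy : 0 ≤ (v : ℝ) * ((u : ℝ) + v) * c := by positivity
    refine le_of_pow_le_pow_left' hx hy hvne ?_
    calc (((v : ℝ) + w) * ((u : ℝ) + v + w) * e * r ^ w) ^ v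
        = ρ ^ w * ((((v : ℝ) + w) * ((u : ℝ) + v + w) * e)) ^ v := by rw [mul_pow, hrw, mul_comm]
      _ ≤ ((v : ℝ) * ((u : ℝ) + v) * c) ^ v := h1
  -- T₂(r) < 0
  have hT : (u : ℝ) * b - ((u : ℝ) + v) * c * r ^ v + ((u : ℝ) + v + w) * e * r ^ (v + w) < 0 := by
    have hlt : ((u : ℝ) + v + w) * e * r ^ (v + w) < (lam - 1) * ((u : ℝ) * b) := by
      refine lt_of_pow_lt_pow_left' h2' v ?_
      calc (((u : ℝ) + v + w) * e * r ^ (v + w)) ^ v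
          = (((u : ℝ) + v + w) * e) ^ v * ρ ^ (v + w) := by rw [mul_pow, hrvw]
        _ < ((lam - 1) * ((u : ℝ) * b)) ^ v := h2
    have hmid : ((u : ℝ) + v) * c * r ^ v = lam * ((u : ℝ) * b) := by rw [hrv, mul_comm, hρdef]
    nlinarith
  -- Φ(r) > 0, keeping the e-term
  have hΦ : 0 < (u : ℝ) * a - (v : ℝ) * c * r ^ (u + v) + ((v : ℝ) + w) * e * r ^ (u + v + w) := by
    have h1k : 0 ≤ (1 + kap) * ((u : ℝ) * a) := by positivity
    have hlt : (v : ℝ) * c * r ^ (u + v) < (1 + kap) * ((u : ℝ) * a) := by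
      refine lt_of_pow_lt_pow_left' h1k v ?_
      calc ((v : ℝ) * c * r ^ (u + v)) ^ v = ((v : ℝ) * c) ^ v * ρ ^ (u + v) := by rw [mul_pow, hruv]
        _ < ((1 + kap) * ((u : ℝ) * a)) ^ v := h3a
    have hge : kap * ((u : ℝ) * a) ≤ ((v : ℝ) + w) * e * r ^ (u + v + w) := by
      have hx : 0 ≤ kap * ((u : ℝ) * a) := by positivity
      have hy : 0 ≤ ((v : ℝ) + w) * e * r ^ (u + v + w) := by positivity
      refine le_of_pow_le_pow_left' hx hy hvne ?_
      calc (kap * ((u : ℝ) * a)) ^ v ≤ (((v : ℝ) + w) * e) ^ v * ρ ^ (u + v + w) := h3b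
        _ = (((v : ℝ) + w) * e * r ^ (u + v + w)) ^ v := by rw [← hruvw, ← mul_pow]
    nlinarith
  exact fourNomial_countP_posRoots_le_two_of_left_centre_witness hu hv hw ha hb hc he hr hcen hT hΦ

/-- **PARAMETRIC RIGHT ROW, SHARPENED, WITH MULTIPLICITY.**  `u, v, w ≥ 1`, `a, b, c, e > 0`, `1 ≤ μ`, `0 < t` with
`μ(u+v) + t(u+v+w) < u+v+w`, `ρ := μ·v(u+v)c/((v+w)(u+v+w)e) > 0` (the point `r = ρ^(1/w)` is at or right of the common centre).
If EITHER `v + w ≤ μv` OR `(((v+w)−μv)(u+v)c)^w·ρ^v < ((v+w)ub)^w` (each gives `T₂(r) > 0`, because the centre tie makes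
`(v+w)·T₂(r) = (v+w)ub − ((v+w)−μv)(u+v)c·r^v`), and `(ua)^w ≤ (tvc)^w·ρ^(u+v)` (then `Φ(r) < 0`), the window 4-nomial has at most two
positive roots COUNTED WITH MULTIPLICITY. [folklore] -/
theorem fourNomial_countP_posRoots_le_two_of_right_param_sharp {u v w : ℕ} (hu : 0 < u) (hv : 0 < v) (hw : 0 < w)
    {a b c e mu t : ℝ} (ha : 0 < a) (hb : 0 < b) (hc : 0 < c) (he : 0 < e) (hmu : 1 ≤ mu) (ht : 0 < t)
    (hmut : mu * ((u : ℝ) + v) + t * ((u : ℝ) + v + w) < (u : ℝ) + v + w) {ρ : ℝ} (hρ : 0 < ρ)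
    (hρdef : ρ * (((v : ℝ) + w) * ((u : ℝ) + v + w) * e) = mu * ((v : ℝ) * ((u : ℝ) + v) * c))
    (h2 : (v : ℝ) + w ≤ mu * v ∨
      ((((v : ℝ) + w) - mu * v) * (((u : ℝ) + v) * c)) ^ w * ρ ^ v < (((v : ℝ) + w) * ((u : ℝ) * b)) ^ w)
    (h3 : ((u : ℝ) * a) ^ w ≤ (t * ((v : ℝ) * c)) ^ w * ρ ^ (u + v)) :
    (C a - C b * X ^ u + C c * X ^ (u + v) - C e * X ^ (u + v + w)).roots.countP (fun x => 0 < x) ≤ 2 := by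
  obtain ⟨r, hr, hrw⟩ := exists_pos_pow_eq hρ hw
  have hwne : w ≠ 0 := hw.ne'
  have hrv : (r ^ v) ^ w = ρ ^ v := by rw [← pow_mul, mul_comm, pow_mul, hrw]
  have hruv : (r ^ (u + v)) ^ w = ρ ^ (u + v) := by rw [← pow_mul, mul_comm, pow_mul, hrw]
  -- centre tie and centre inequality (μ ≥ 1)
  have hkey : ((v : ℝ) + w) * ((u : ℝ) + v + w) * e * r ^ w = mu * ((v : ℝ) * ((u : ℝ) + v) * c) := by
    rw [hrw, mul_comm, hρdef]
  have hcen : (v : ℝ) * ((u : ℝ) + v) * c ≤ ((v : ℝ) + w) * ((u : ℝ) + v + w) * e * r ^ w := by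
    rw [hkey]
    have h0 : 0 ≤ (v : ℝ) * ((u : ℝ) + v) * c := by positivity
    nlinarith
  have hvw : (0 : ℝ) < (v : ℝ) + w := by positivity
  have hcrv : 0 < ((u : ℝ) + v) * c * r ^ v := by positivity
  -- (v+w)·T₂(r) = (v+w)ub − ((v+w) − μv)(u+v)c r^v
  have hT2id : ((v : ℝ) + w) * ((u : ℝ) * b - ((u : ℝ) + v) * c * r ^ v + ((u : ℝ) + v + w) * e * r ^ (v + w))
      = ((v : ℝ) + w) * ((u : ℝ) * b) - (((v : ℝ) + w) - mu * v) * (((u : ℝ) + v) * c * r ^ v) := by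
    have hsplit : ((u : ℝ) + v + w) * e * r ^ (v + w) = (((v : ℝ) + w) * ((u : ℝ) + v + w) * e * r ^ w) * r ^ v / ((v : ℝ) + w) := by
      field_simp
      ring
    rw [hsplit, hkey]
    field_simp
    ring
  -- T₂(r) > 0
  have hT : 0 < (u : ℝ) * b - ((u : ℝ) + v) * c * r ^ v + ((u : ℝ) + v + w) * e * r ^ (v + w) := by
    have hpos : 0 < ((v : ℝ) + w) * ((u : ℝ) * b) - (((v : ℝ) + w) - mu * v) * (((u : ℝ) + v) * c * r ^ v) := by
      rcases h2 with hfar | hnear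
      · have hnp : (((v : ℝ) + w) - mu * v) * (((u : ℝ) + v) * c * r ^ v) ≤ 0 :=
          mul_nonpos_of_nonpos_of_nonneg (by linarith) hcrv.le
        have hub : 0 < ((v : ℝ) + w) * ((u : ℝ) * b) := by positivity
        linarith
      · have hlt : (((v : ℝ) + w) - mu * v) * (((u : ℝ) + v) * c) * r ^ v < ((v : ℝ) + w) * ((u : ℝ) * b) := by
          refine lt_of_pow_lt_pow_left' (by positivity) w ?_
          calc ((((v : ℝ) + w) - mu * v) * (((u : ℝ) + v) * c) * r ^ v) ^ w
              = ((((v : ℝ) + w) - mu * v) * (((u : ℝ) + v) * c)) ^ w * ρ ^ v := by rw [mul_pow, hrv]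
            _ < (((v : ℝ) + w) * ((u : ℝ) * b)) ^ w := hnear
        have : (((v : ℝ) + w) - mu * v) * (((u : ℝ) + v) * c * r ^ v)
            = (((v : ℝ) + w) - mu * v) * (((u : ℝ) + v) * c) * r ^ v := by ring
        linarith
    rw [← hT2id] at hpos
    exact (mul_pos_iff_of_pos_left hvw).mp hpos
  -- Φ(r) < 0 (verbatim the argument of `…right_param`)
  have hΦ : (u : ℝ) * a - (v : ℝ) * c * r ^ (u + v) + ((v : ℝ) + w) * e * r ^ (u + v + w) < 0 := by
    have hle : (u : ℝ) * a ≤ t * ((v : ℝ) * c) * r ^ (u + v) := by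
      have hx : 0 ≤ (u : ℝ) * a := by positivity
      have hy : 0 ≤ t * ((v : ℝ) * c) * r ^ (u + v) := by positivity
      refine le_of_pow_le_pow_left' hx hy hwne ?_
      calc ((u : ℝ) * a) ^ w ≤ (t * ((v : ℝ) * c)) ^ w * ρ ^ (u + v) := h3
        _ = (t * ((v : ℝ) * c) * r ^ (u + v)) ^ w := by rw [← hruv, ← mul_pow]
    have hsplit : ((v : ℝ) + w) * e * r ^ (u + v + w)
        = (((v : ℝ) + w) * ((u : ℝ) + v + w) * e * r ^ w) * r ^ (u + v) / ((u : ℝ) + v + w) := by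
      have hU : ((u : ℝ) + v + w) ≠ 0 := by positivity
      field_simp
      ring
    rw [hsplit, hkey]
    have hruvpos : 0 < r ^ (u + v) := by positivity
    have hvc : 0 < (v : ℝ) * c := by positivity
    have hU : 0 < (u : ℝ) + v + w := by positivity
    have hcoef : mu * ((u : ℝ) + v) / ((u : ℝ) + v + w) + t < 1 := by
      rw [div_add' _ _ _ hU.ne', div_lt_one hU]; linarith
    have : (u : ℝ) * a - (v : ℝ) * c * r ^ (u + v)
        + mu * ((v : ℝ) * ((u : ℝ) + v) * c) * r ^ (u + v) / ((u : ℝ) + v + w)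
        ≤ ((v : ℝ) * c * r ^ (u + v)) * (t - 1 + mu * ((u : ℝ) + v) / ((u : ℝ) + v + w)) := by
      have hexp : ((v : ℝ) * c * r ^ (u + v)) * (t - 1 + mu * ((u : ℝ) + v) / ((u : ℝ) + v + w))
          = t * ((v : ℝ) * c) * r ^ (u + v) - (v : ℝ) * c * r ^ (u + v)
            + mu * ((v : ℝ) * ((u : ℝ) + v) * c) * r ^ (u + v) / ((u : ℝ) + v + w) := by
        field_simp
      rw [hexp]; linarith
    have hneg : ((v : ℝ) * c * r ^ (u + v)) * (t - 1 + mu * ((u : ℝ) + v) / ((u : ℝ) + v + w)) < 0 := by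
      apply mul_neg_of_pos_of_neg (by positivity)
      linarith
    linarith
  exact fourNomial_countP_posRoots_le_two_of_right_centre_witness hu hv hw ha hb hc he hr hcen hT hΦ

end Summit.ValiantsHypothesis.ValiantsHypothesis.Theorems.LacunarySymmetroidMatrixDescartes.Census
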